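import Summits.Langlands.Langlands.Theorems.QuarterDeficit1951IcosahedralSupplyOfDeRham1951
import Literature.NumberTheory.PAdicHodge.BdRFiniteImage

/-!
# Route `QuarterDeficit1951` (Langlands) — crux `IcosahedralSupply` (stmt-Langlands-15899), line `Sketch`

**The crux reduced to ONE equation about the pinned datum: its period ring at `(ℚ_1951, 1951)` is
Fontaine's `B_dR`.**

Continuation lead c2 (2026-08-17).  The previous reduction
(`IcosahedralSupply_of_finiteImage_isDeRhamFramed_1951`, file `…OfDeRham1951`) left the statement
"finite-image local representations `Γ_{ℚ_v} → GL_n(ℚ̄_1951)`, `v = (1951)`, are de Rham for the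
PINNED datum `fontainePstAdicCompletion v 1951 hv = Classical.epsilon (IsFontaineDatum _)`".  Its
mathematical content is now PROVED in the tree for the genuine ring: the Literature files
`GaloisRepresentations/PotentiallyTrivialAdmissible` (Hilbert-90 period matrix over a finite Galois
`L/F`; potentially trivial representations are `B`-admissible for every period ring receiving `F̄`
equivariantly) and `PAdicHodge/BdRFiniteImage` (specialisation to `bdRPeriodRingData`, Fontaine's
`B_dR(F)` with `B_dR^{Γ_F} = F` by Ax–Sen–Tate, through the equivariant section `F̄ ↪ B_dR⁺`;
clause form `PstWeilDeligneData.isDeRhamFramed_of_finite_range_of_bdR`).  Consequently: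

* `IcosahedralSupply_of_pst_periodRing_eq_bdR` — **the crux follows from the single equation
  `(fontainePstAdicCompletion v 1951 hv).𝔅 = bdRPeriodRingData _`** (for the datum's own
  `ℚ_1951`-structure) at the place `v` of `ℚ` above `1951`.  This equation is exactly the D1 half of
  the "Upgrade path" of `Literature/NumberTheory/PAdicHodge/FontaineDpst.lean` (replace the body of
  `fontainePst` by the construction; `bdRPeriodRingData` IS that construction for the period ring)
  and is the precise as-typed blocker of the crux: for the `ε`-pinned datum it is neither provable
  nor refutable today.
* `isDeRhamFramed_fontainePstAdicCompletion_of_finite_range` — the old stub, discharged modulo the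
  same equation, for every number field `K`, prime `ℓ` and place `v ∣ ℓ`.

The cheap route-level alternative is unchanged: the deciding theorem `closes` uses the crux only at
`ℓ = 17`, and the restated crux `17 ≤ ℓ → ℓ ≠ 1951 → …` IS `IcosahedralSupply_away`.
-/

set_option linter.dupNamespace false

noncomputable section

open scoped NumberField MatrixGroups
open Field IsDedekindDomain ValuativeRel
open Literature.NumberTheory.GaloisRepresentations Literature.NumberTheory.PAdicHodge

namespace Summit.Langlands.Langlands.Theorems.QuarterDeficit1951

/-- **The old stub modulo the upgrade equation.**  For a number field `K`, a prime `ℓ` and a place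
`v ∣ ℓ`: if the period ring of the pinned datum `fontainePstAdicCompletion v ℓ hv` is Fontaine's
`B_dR(K_v)` (`bdRPeriodRingData`, for the datum's own `ℚ_ℓ`-structure), then every finite-image
local representation `Γ_{K_v} → GL_n(ℚ̄_ℓ)` is de Rham for the pinned datum (accepted
`PstWeilDeligneData.isDeRhamFramed_of_finite_range_of_bdR`: Hilbert 90 over a finite Galois
splitting field, `F̄ ↪ B_dR⁺`, Fontaine's inequality).
[cite: FontaineAsterisque223III, Exp. III §1.5 and §3] [cite: FontaineMazurGeometric1995, §1] -/
theorem isDeRhamFramed_fontainePstAdicCompletion_of_finite_range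
    {K : Type} [Field K] [NumberField K] (v : HeightOneSpectrum (𝓞 K)) (ℓ : ℕ) [Fact ℓ.Prime]
    (hv : ((ℓ : ℕ) : 𝓞 K) ∈ v.asIdeal) [CharZero (v.adicCompletion K)]
    [Fact (¬ IsUnit ((ℓ : ℕ) : integerC (v.adicCompletion K)))]
    [IsAdicComplete (Ideal.span {((ℓ : ℕ) : integerC (v.adicCompletion K))}) (integerC (v.adicCompletion K))]
    (h𝔅 : (fontainePstAdicCompletion v ℓ hv).𝔅 =
      @bdRPeriodRingData (v.adicCompletion K) _ _ _ _ _ ℓ _ _ _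
        (LocalField.valuation_adicCompletion_natCast_lt_one v ℓ hv) (fontainePstAdicCompletion v ℓ hv).algebra)
    {n : ℕ} (r : FramedGaloisRep (v.adicCompletion K) (PadicAlgCl ℓ) n) (hr : (Set.range r).Finite) :
    (fontainePstAdicCompletion v ℓ hv).IsDeRhamFramed r :=
  PstWeilDeligneData.isDeRhamFramed_of_finite_range_of_bdR _ _ h𝔅 r hr

/-- **The crux from ONE equation about the pinned datum** (item stmt-Langlands-15899): if at the
place `v` of `ℚ` above `1951` the period ring of the pinned `p`-adic Hodge datum
`fontainePstAdicCompletion v 1951 hv` is Fontaine's `B_dR(ℚ_v)` (`bdRPeriodRingData`; the D1 half of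
the Upgrade path of `FontaineDpst` — for the `ε`-pinned datum an undecidable equation today), then
`IcosahedralSupply` holds: `IcosahedralSupply_of_finiteImage_isDeRhamFramed_1951` with its hypothesis
(finite-image local representations are de Rham for the pinned datum) supplied by the PROVED theorem
for the genuine ring (`isDeRhamFramed_fontainePstAdicCompletion_of_finite_range`; the instances
`CharZero`, `¬ IsUnit 1951`, `IsAdicComplete` of `𝒪_{ℂ_v}` are the accepted
`LocalField.charZero_adicCompletion`, `not_isUnit_natCast_integerC`, `isAdicComplete_integerC_natCast`).
[cite: FontaineAsterisque223III, Exp. III §1.5 and §3] [cite: DoudMoore2006, §2 and §4] -/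
theorem IcosahedralSupply_of_pst_periodRing_eq_bdR
    (H : ∀ [Fact (Nat.Prime 1951)] (v : HeightOneSpectrum (𝓞 ℚ))
      (hv : ((1951 : ℕ) : 𝓞 ℚ) ∈ v.asIdeal) [CharZero (v.adicCompletion ℚ)]
      [Fact (¬ IsUnit ((1951 : ℕ) : integerC (v.adicCompletion ℚ)))]
      [IsAdicComplete (Ideal.span {((1951 : ℕ) : integerC (v.adicCompletion ℚ))})
        (integerC (v.adicCompletion ℚ))],
      (fontainePstAdicCompletion v 1951 hv).𝔅 =
        @bdRPeriodRingData (v.adicCompletion ℚ) _ _ _ _ _ 1951 _ _ _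
          (LocalField.valuation_adicCompletion_natCast_lt_one v 1951 hv)
          (fontainePstAdicCompletion v 1951 hv).algebra) :
    Summit.Langlands.Langlands.Theses.QuarterDeficit1951.IcosahedralSupply :=
  IcosahedralSupply_of_finiteImage_isDeRhamFramed_1951 fun v hv _ r hr => by
    haveI := LocalField.charZero_adicCompletion v
    haveI : Fact (¬ IsUnit ((1951 : ℕ) : integerC (v.adicCompletion ℚ))) :=
      ⟨not_isUnit_natCast_integerC (LocalField.valuation_adicCompletion_natCast_lt_one v 1951 hv)⟩
    haveI := isAdicComplete_integerC_natCast (F := v.adicCompletion ℚ) (p := 1951)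
      (LocalField.valuation_adicCompletion_natCast_lt_one v 1951 hv)
    exact isDeRhamFramed_fontainePstAdicCompletion_of_finite_range v 1951 hv (H v hv) r hr

end Summit.Langlands.Langlands.Theorems.QuarterDeficit1951

end
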